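import Literature.MathematicalPhysics.QuantumFieldTheory.Balaban1983to89.B9Eq340ProbeBridgeSNtoKA

/-!
# `Balaban1983to89.B9Eq340ProbeBridgeDstarSN` — T. Bałaban, *Propagators for lattice gauge theories in a background field*, Commun. Math. Phys. **99** (1985) 389–434
# [Balaban1985BackgroundPropagators], (3.43)₂ p. 398 «|G′(U)∇\*_U f|_β ≦ …»: the SITE PROBE member of `G′ ∘ ∇\*_U` read on node00-def-Y's BOND-SECTOR source `DvscoKH` from the
# member on dag-n06-d's direction-packed site source `DscoS` — the `∇\*`-side twin of `B9Eq340ProbeBridgeSNtoKA` (the probe form of def-Y's e2-transfer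
# `Node00.OpsYNablaBridge.hasMajorantHom_GcoS_DvscoKH_of_compat`)

[4] = T. Bałaban, *Propagators and renormalization transformations for lattice gauge theories. II*, Commun. Math. Phys. **96** (1984) 223–250 [`Balaban1984PropagatorsII`].
statement-level skeleton of published theorems with citation tags; proofs where landed; nothing here is a claim about the Yang–Mills mass gap.

THE PRINT.  (3.8) p. 392 (`∇\*_U` = the covariant divergence, a sum over directions); Thm 3.1 (3.43) p. 398, second member `G′(U)∇\*_U` into the Hölder class; (3.39)–(3.40) p. 397.

WHY THIS FILE (cell `pub-ymgap`, node N06 [B9], seat `pub-ymgap-dag-n06-c` g19; the `h43Gp` road of the rows-20–21 G′ Hölder layer, road memo `pub-ymgap-dag-n06-c/HPDGW-ROAD.md`).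
n06-k's engine (`holder343_of_local37_dir`, right member) gives `Φ^X_β ∘ (G′ ∘ ∇\*_U)` at the operator record's direction-packed site letters (`Gp = GcoS … O`, `Dstar = DscoS`), i.e.
with SOURCE the site carrier `XSK`; the certificate's binder `h43Gp` reads `GcoS … ∘ DvscoKH …` with SOURCE the bond carrier `XBK` (class `𝔠⁽⁰⁾_{blkBK bI}`).  Def-Y's identity
`(GcoS O ∘ DvscoKH) A (z, ν, c, c′) = (c_f·η)·Σ_μ (GcoS O ∘ DscoS)(dirSliceK μ ν A)(z, μ, c, c′)` (`GcoS_DvscoKH_apply_eq_sum`) is a DIRECTION SUM WITH A SLOT CHANGE; the probe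
letters `probeK b g w w₀` are slot-diagonal and linear, and the probe anchors `blkPK (sIK bI)` are slot-blind — so every probe of `(GcoS O ∘ DvscoKH) A` is `(c_f·η)·Σ_μ` (the same probe,
re-slotted) of `(GcoS O ∘ DscoS)(dirSliceK μ ν A)`, each slice being supported in the same block with no larger sup (direction-blind `bI`).  Cost: the factor `d + 1` (and `|c_f|η = 1`).
* §1 ★ `assembleK_of_dirSum`, ★ `probeK_inl_of_dirSum ∕ probeK_inr_inl_of_dirSum ∕ probeK_inr_inr_of_dirSum` — the probe identities for ANY pair `(T′, T)` related by a direction sum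
  `T′ A (z, ν, c, c′) = γ·Σ_μ T (dirSliceK μ ν A) (z, μ, c, c′)`.
* §2 ★★★ `hasMaj_probe_of_dirSum` — `HasMaj 𝔠⁽⁰⁾_{blkSK(sIK bI)} 𝔠_P^{(β−1)}_{blkPK(sIK bI)} (probeK b g w w₀ ∘ₗ T) (C_b e^{−δd})` ⟹
  `HasMaj 𝔠⁽⁰⁾_{blkBK bI} 𝔠_P^{(β−1)}_{blkPK(sIK bI)} (probeK b g w w₀ ∘ₗ T′) ((d+1)|γ|C_b e^{−δd})` (direction-blind `bI`).
* §3 ★★★ `hasMaj_probesSN_GcoS_DvscoKH_of_DscoS` — the instance `T′ = GcoS O ∘ DvscoKH`, `T = GcoS O ∘ DscoS`, `γ = c_f·η`, probes `holderProbesSN … par bI` (any table `par`),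
  constant `(d+1)·C_b` under print's units `|c_f| = N_T`; ★ `hasMaj_probesSN_DvscoKH_of_DscoS` — the same for `∇\*_U` alone (`T′ = DvscoKH`, `T = DscoS`).
HONEST SCOPE.  Linear bookkeeping over landed identities; no estimate of [B9] asserted; COUNT-NEUTRAL; N06 NOT discharged; nothing continuum, nothing about the mass gap.  Cell
`pub-ymgap` (HUMAN RULING D-0062), Track A node N06 [B9], seat `pub-ymgap-dag-n06-c` (g19), 2026-08-29; a NEW file; 0 `def`, no `sorry`, no `axiom`, no `instance`, no `notation`.
-/

noncomputable section

namespace Literature.MathematicalPhysics.QuantumFieldTheory.Balaban1983to89.B9Eq340ProbeBridgeDstarSN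

open B9Eq39Adjoint (R R_smul R_sub)
open B6GlobalChartV1 (PV)
open B6KLevelCensusIndexV1 (KIdx)
open B6Prop22KLevelTorusCensusEta (nKT nKT_pos)
open B9Thm34Ext (toB6)
open B9GeoNormsKLevelV1 (geo9K)
open B9GeoLemma21KLevelV1 (geo9K_len_pos)
open B9CoReadingCoords (assembleK assembleK_smul XBK blkBK)
open B9CoReadingCoordsS (XSK blkSK sIK GcoS DscoS)
open Node00.OpsYSectDCoords (DvscoKH)
open B9CoReadingCoordsHolder (PK blkPK probeK probeK_inl probeK_inr_inl probeK_inr_inr)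
open B9CoReadingCoordsHolderSNear (wSN holderProbesSN ΦX_SN_eq)
open Node00 (SiteY FBondY IBondY CfgY SiteOpY SiteParY toKT etaS)
open Node00.OpsYNablaBridge (chartY dirSliceK dirSliceK_apply GcoS_DvscoKH_apply_eq_sum DvscoKH_apply_eq_sum compat_blkSK_blkBK)
open B9Ineq349SiteComposite (etaS_pos)
open B9Thm312Whole (GeoOK)
open B9Thm312WholeClasses (cNormR cNormR_loc cNormR_isLoc)
open B9SmoothHolderClassTClosure (abs_apply_le_of_hasMaj_cNormR)
open B11SectG (BlockNorm HasMaj)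

variable {d ℓ : ℕ} {hd : 1 ≤ d + 1} {hL : Odd (ℓ + 1) ∧ 1 < ℓ + 1} {b₀ b₁ : ℝ}
variable {𝔸 : Type} [NormedRing 𝔸] [NormedAlgebra ℂ 𝔸] [CompleteSpace 𝔸]
variable {κ : Type} [Fintype κ]

/-! ## §0 Two private block-sup facts and `R` of a finite sum -/

section Aux

variable (i : KIdx d ℓ hd hL b₀ b₁)

/-- a value on the block is below the sharp-block sup. [folklore] -/
private theorem abs_le_ofBlocks_loc [Fintype (geo9K i).Site] {X : Type} [Fintype X] {R₀ : ℝ} {H₀ : Prop} (blk : X → IBondY i) {y : IBondY i} (f : X → ℝ) {x : X}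
    (hx : blk x = y) : |f x| ≤ (BlockNorm.ofBlocks (toB6 (geo9K i) R₀ H₀) blk).loc y f := by
  classical
  show |f x| ≤ ⨆ x : X, @ite ℝ (blk x = y) (Classical.propDecidable _) |f x| 0
  refine le_trans ?_ (le_ciSup (Finite.bddAbove_range _) x)
  rw [if_pos hx]

/-- the sharp-block sup of `f` at `y` is below any `M ≥ 0` bounding `|f|` on the block. [folklore] -/
private theorem ofBlocks_loc_le_of_forall [Fintype (geo9K i).Site] {X : Type} [Fintype X] {R₀ : ℝ} {H₀ : Prop} (blk : X → IBondY i) {y : IBondY i}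
    {f : X → ℝ} {M : ℝ} (hM : 0 ≤ M) (h : ∀ x, blk x = y → |f x| ≤ M) : (BlockNorm.ofBlocks (toB6 (geo9K i) R₀ H₀) blk).loc y f ≤ M := by
  classical
  show (⨆ x : X, @ite ℝ (blk x = y) (Classical.propDecidable _) |f x| 0) ≤ M
  refine Real.iSup_le (fun x => ?_) hM
  split_ifs with hx
  · exact h x hx
  · exact hM

omit [NormedAlgebra ℂ 𝔸] [CompleteSpace 𝔸] in
/-- `R(U)` of a finite sum. [folklore] -/
private theorem R_finset_sum {ι : Type} (s : Finset ι) (U : 𝔸ˣ) (X : ι → 𝔸) : R U (∑ j ∈ s, X j) = ∑ j ∈ s, R U (X j) := by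
  simp only [B9Eq39Adjoint.R_def, Finset.mul_sum, Finset.sum_mul]

end Aux

/-! ## §1 The probe identities under a direction sum with a slot change -/

section Pointwise

variable (i : KIdx d ℓ hd hL b₀ b₁) (b : Module.Basis κ ℝ 𝔸)
variable {T' : (XBK κ i → ℝ) →ₗ[ℝ] (XSK κ i → ℝ)} {T : (XSK κ i → ℝ) →ₗ[ℝ] (XSK κ i → ℝ)} {γ : ℝ}

omit [CompleteSpace 𝔸] in
/-- ★ the assembled `ν`-slot value of a direction sum is `γ·Σ_μ` the assembled `μ`-slot values of the slices. [cite: Balaban1985BackgroundPropagators, (3.8) p.392, bookkeeping] -/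
theorem assembleK_of_dirSum (hT : ∀ (A : XBK κ i → ℝ) (z : SiteY i) (ν : Fin (d + 1)) (c c' : κ), T' A (z, ν, c, c') = γ * ∑ μ : Fin (d + 1), T (dirSliceK i μ ν A) (z, μ, c, c'))
    (A : XBK κ i → ℝ) (ν : Fin (d + 1)) (c' : κ) (z : SiteY i) :
    assembleK b ν c' (T' A) z = γ • ∑ μ : Fin (d + 1), assembleK b μ c' (T (dirSliceK i μ ν A)) z := by
  simp only [assembleK, hT, Finset.mul_sum, Finset.sum_smul, mul_smul, Finset.smul_sum]
  exact Finset.sum_comm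

omit [CompleteSpace 𝔸] in
/-- ★ the PAIR probe of a direction sum = `γ·Σ_μ` the re-slotted pair probes of the slices. [cite: Balaban1985BackgroundPropagators, (3.40) p.397 + (3.8) p.392, bookkeeping] -/
theorem probeK_inl_of_dirSum (g : SiteY i → SiteY i → 𝔸ˣ) (w : SiteY i → SiteY i → ℝ) (w₀ : SiteY i → ℝ)
    (hT : ∀ (A : XBK κ i → ℝ) (z : SiteY i) (ν : Fin (d + 1)) (c c' : κ), T' A (z, ν, c, c') = γ * ∑ μ : Fin (d + 1), T (dirSliceK i μ ν A) (z, μ, c, c'))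
    (A : XBK κ i → ℝ) (x x' : SiteY i) (ν : Fin (d + 1)) (a c' : κ) :
    probeK b g w w₀ (T' A) (Sum.inl ((x, x'), ν, a, c')) =
      γ * ∑ μ : Fin (d + 1), probeK b g w w₀ (T (dirSliceK i μ ν A)) (Sum.inl ((x, x'), μ, a, c')) := by
  simp only [probeK_inl]
  rw [assembleK_of_dirSum i b hT, assembleK_of_dirSum i b hT, R_smul, R_finset_sum, ← smul_sub, ← Finset.sum_sub_distrib, map_smul, map_sum,
    Finsupp.smul_apply, Finsupp.coe_finsetSum, Finset.sum_apply, smul_eq_mul, Finset.mul_sum, Finset.mul_sum, Finset.mul_sum]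
  refine Finset.sum_congr rfl fun μ _ => ?_
  ring

omit [CompleteSpace 𝔸] in
/-- ★ the TRANSPORTED POINT probe of a direction sum. [cite: Balaban1985BackgroundPropagators, (3.40) p.397 + (3.8) p.392, bookkeeping] -/
theorem probeK_inr_inl_of_dirSum (g : SiteY i → SiteY i → 𝔸ˣ) (w : SiteY i → SiteY i → ℝ) (w₀ : SiteY i → ℝ)
    (hT : ∀ (A : XBK κ i → ℝ) (z : SiteY i) (ν : Fin (d + 1)) (c c' : κ), T' A (z, ν, c, c') = γ * ∑ μ : Fin (d + 1), T (dirSliceK i μ ν A) (z, μ, c, c'))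
    (A : XBK κ i → ℝ) (x x' : SiteY i) (ν : Fin (d + 1)) (a c' : κ) :
    probeK b g w w₀ (T' A) (Sum.inr (Sum.inl ((x, x'), ν, a, c'))) =
      γ * ∑ μ : Fin (d + 1), probeK b g w w₀ (T (dirSliceK i μ ν A)) (Sum.inr (Sum.inl ((x, x'), μ, a, c'))) := by
  simp only [probeK_inr_inl]
  rw [assembleK_of_dirSum i b hT, R_smul, R_finset_sum, map_smul, map_sum, Finsupp.smul_apply, Finsupp.coe_finsetSum, Finset.sum_apply, smul_eq_mul,
    Finset.mul_sum, Finset.mul_sum, Finset.mul_sum]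
  refine Finset.sum_congr rfl fun μ _ => ?_
  ring

omit [CompleteSpace 𝔸] in
/-- ★ the POINT probe of a direction sum. [cite: Balaban1985BackgroundPropagators, (3.39) p.397 + (3.8) p.392, bookkeeping] -/
theorem probeK_inr_inr_of_dirSum (g : SiteY i → SiteY i → 𝔸ˣ) (w : SiteY i → SiteY i → ℝ) (w₀ : SiteY i → ℝ)
    (hT : ∀ (A : XBK κ i → ℝ) (z : SiteY i) (ν : Fin (d + 1)) (c c' : κ), T' A (z, ν, c, c') = γ * ∑ μ : Fin (d + 1), T (dirSliceK i μ ν A) (z, μ, c, c'))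
    (A : XBK κ i → ℝ) (x : SiteY i) (ν : Fin (d + 1)) (c c' : κ) :
    probeK b g w w₀ (T' A) (Sum.inr (Sum.inr (x, ν, c, c'))) =
      γ * ∑ μ : Fin (d + 1), probeK b g w w₀ (T (dirSliceK i μ ν A)) (Sum.inr (Sum.inr (x, μ, c, c'))) := by
  simp only [probeK_inr_inr]
  rw [hT, Finset.mul_sum, Finset.mul_sum, Finset.mul_sum]
  refine Finset.sum_congr rfl fun μ _ => ?_
  ring

end Pointwise

/-! ## §2 ★★★ The probe member under a direction sum with a slot change -/

section Transfer

variable (i : KIdx d ℓ hd hL b₀ b₁) (b : Module.Basis κ ℝ 𝔸) [Fintype (geo9K i).Site] {bI : FBondY i → IBondY i} {R₀ : ℝ} {H₀ : Prop}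
variable {T' : (XBK κ i → ℝ) →ₗ[ℝ] (XSK κ i → ℝ)} {T : (XSK κ i → ℝ) →ₗ[ℝ] (XSK κ i → ℝ)} {γ : ℝ}

omit [CompleteSpace 𝔸] in
/-- ★★★ **THE PROBE e2-TRANSFER.**  For a direction-blind bond block map `bI` and any slot-diagonal probe letters `probeK b g w w₀` anchored by `blkPK (sIK bI)`: if
`T′ A (z, ν, c, c′) = γ·Σ_μ T (dirSliceK μ ν A) (z, μ, c, c′)` and `probeK ∘ T` is bounded `𝔠⁽⁰⁾_{blkSK(sIK bI)} → 𝔠_P^{(β−1)}_{blkPK(sIK bI)}` by `C_b e^{−δd}`, then `probeK ∘ T′` is bounded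
`𝔠⁽⁰⁾_{blkBK bI} → 𝔠_P^{(β−1)}_{blkPK(sIK bI)}` by `(d+1)|γ|C_b e^{−δd}`: each slice `dirSliceK μ ν A` of a bond vector supported in the block `y′` is a site vector supported in `y′` with no
larger sup; §1's identities and the triangle inequality over the `d + 1` directions. [cite: Balaban1985BackgroundPropagators, (3.43) p.398 + (3.8) p.392 + (3.39)–(3.40) p.397; Balaban1984PropagatorsII, (2.51)–(2.52) p.232] -/
theorem hasMaj_probe_of_dirSum (hG : GeoOK (geo9K i)) (hbI0 : ∀ x : FBondY i, bI x = bI ⟨x.src, 0⟩)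
    (g : SiteY i → SiteY i → 𝔸ˣ) (w : SiteY i → SiteY i → ℝ) (w₀ : SiteY i → ℝ)
    (hT : ∀ (A : XBK κ i → ℝ) (z : SiteY i) (ν : Fin (d + 1)) (c c' : κ), T' A (z, ν, c, c') = γ * ∑ μ : Fin (d + 1), T (dirSliceK i μ ν A) (z, μ, c, c'))
    {βh Cb δ : ℝ} (hCb : 0 ≤ Cb)
    (hpr : HasMaj (cNormR R₀ H₀ (blkSK i (sIK i bI)) hG.lenle 0) (cNormR R₀ H₀ (blkPK (sIK i bI)) hG.lenle (βh - 1)) (probeK b g w w₀ ∘ₗ T)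
      (fun a a' => Cb * Real.exp (-(δ * (geo9K i).dist a a')))) :
    HasMaj (cNormR R₀ H₀ (blkBK i bI) hG.lenle 0) (cNormR R₀ H₀ (blkPK (sIK i bI)) hG.lenle (βh - 1)) (probeK b g w w₀ ∘ₗ T')
      (fun a a' => ((d + 1 : ℕ) : ℝ) * |γ| * Cb * Real.exp (-(δ * (geo9K i).dist a a'))) := by
  classical
  have hSB := compat_blkSK_blkBK (κ := κ) i (bI := bI) (fun x μ => hbI0 ⟨x, μ⟩)
  intro y' A hA y
  set M : ℝ := (cNormR R₀ H₀ (blkBK i bI) hG.lenle 0).loc y' A with hMdef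
  have hM : 0 ≤ M := (cNormR R₀ H₀ (blkBK i bI) hG.lenle 0).loc_nonneg _ _
  -- the bond below the site slot `(w, μ′, a, c)` of the slice `(μ, ν)` lies in the same block
  have hblk : ∀ (w : SiteY i) (μ μ' ν : Fin (d + 1)) (a c : κ),
      blkBK (κ := κ) i bI (⟨(chartY i).symm w, μ⟩, ν, a, c) = blkSK i (sIK i bI) (w, μ', a, c) := by
    intro w μ μ' ν a c
    have h := hSB ((chartY i).symm w) μ μ' ν a c
    rw [Equiv.apply_symm_apply] at h
    exact h.symm
  -- the slices: supported in `y′`, sup not larger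
  have hFS : ∀ μ ν : Fin (d + 1), (cNormR R₀ H₀ (blkSK i (sIK i bI)) hG.lenle 0).IsLoc y' (dirSliceK i μ ν A) := by
    intro μ ν
    rw [cNormR_isLoc] at hA ⊢
    rintro ⟨w, μ', a, c⟩ hq
    rw [dirSliceK_apply]
    exact hA _ (by rw [hblk w μ μ' ν a c]; exact hq)
  have hMS : ∀ μ ν : Fin (d + 1), (cNormR R₀ H₀ (blkSK i (sIK i bI)) hG.lenle 0).loc y' (dirSliceK i μ ν A) ≤ M := by
    intro μ ν
    rw [hMdef, cNormR_loc, cNormR_loc]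
    refine mul_le_mul_of_nonneg_left ?_ (Real.rpow_nonneg (le_of_lt (geo9K_len_pos i y')) _)
    refine ofBlocks_loc_le_of_forall i (blkSK i (sIK i bI)) ((BlockNorm.ofBlocks (toB6 (geo9K i) R₀ H₀) (blkBK i bI)).loc_nonneg y' A) ?_
    rintro ⟨w, μ', a, c⟩ hq
    rw [dirSliceK_apply]
    exact abs_le_ofBlocks_loc i (blkBK i bI) A (by rw [hblk w μ μ' ν a c]; exact hq)
  -- one re-slotted family of probes anchored at `y`: the direction sum is bounded by `(d+1)|γ|·C_b·len(y)^{1−β}e^{−δd}·M`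
  have hlen0 : 0 < (geo9K i).len y := geo9K_len_pos i y
  have fin : ∀ (ν : Fin (d + 1)) (F : Fin (d + 1) → PK (SiteY i) (Fin (d + 1)) κ), (∀ μ, blkPK (sIK i bI) (F μ) = y) →
      |γ * ∑ μ : Fin (d + 1), probeK b g w w₀ (T (dirSliceK i μ ν A)) (F μ)| ≤
        ((d + 1 : ℕ) : ℝ) * |γ| * Cb * (geo9K i).len y ^ (1 - βh) * Real.exp (-(δ * (geo9K i).dist y y')) * M := by
    intro ν F hF
    have hterm : ∀ μ : Fin (d + 1), |probeK b g w w₀ (T (dirSliceK i μ ν A)) (F μ)| ≤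
        Cb * (geo9K i).len y ^ (1 - βh) * Real.exp (-(δ * (geo9K i).dist y y')) * M := by
      intro μ
      have hv := abs_apply_le_of_hasMaj_cNormR i hG.lenle hpr (hFS μ ν) (F μ)
      have hF' : blkPK (I := (geo9K i).Site) (sIK i bI) (F μ) = y := hF μ
      rw [LinearMap.comp_apply, hF'] at hv
      have e : ((geo9K i).len y ^ (βh - 1))⁻¹ = (geo9K i).len y ^ (1 - βh) := by rw [← Real.rpow_neg hlen0.le, neg_sub]
      rw [e] at hv
      refine hv.trans ?_
      have hl : 0 ≤ (geo9K i).len y ^ (1 - βh) := Real.rpow_nonneg hlen0.le _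
      have hE := Real.exp_nonneg (-(δ * (geo9K i).dist y y'))
      calc (geo9K i).len y ^ (1 - βh) * (Cb * Real.exp (-(δ * (geo9K i).dist y y'))) * (cNormR R₀ H₀ (blkSK i (sIK i bI)) hG.lenle 0).loc y' (dirSliceK i μ ν A)
          ≤ (geo9K i).len y ^ (1 - βh) * (Cb * Real.exp (-(δ * (geo9K i).dist y y'))) * M := by
            refine mul_le_mul_of_nonneg_left (hMS μ ν) ?_; positivity
        _ = Cb * (geo9K i).len y ^ (1 - βh) * Real.exp (-(δ * (geo9K i).dist y y')) * M := by ring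
    rw [abs_mul]
    calc |γ| * |∑ μ : Fin (d + 1), probeK b g w w₀ (T (dirSliceK i μ ν A)) (F μ)|
        ≤ |γ| * ∑ μ : Fin (d + 1), |probeK b g w w₀ (T (dirSliceK i μ ν A)) (F μ)| :=
          mul_le_mul_of_nonneg_left (Finset.abs_sum_le_sum_abs _ _) (abs_nonneg _)
      _ ≤ |γ| * ∑ _μ : Fin (d + 1), Cb * (geo9K i).len y ^ (1 - βh) * Real.exp (-(δ * (geo9K i).dist y y')) * M :=
          mul_le_mul_of_nonneg_left (Finset.sum_le_sum fun μ _ => hterm μ) (abs_nonneg _)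
      _ = ((d + 1 : ℕ) : ℝ) * |γ| * Cb * (geo9K i).len y ^ (1 - βh) * Real.exp (-(δ * (geo9K i).dist y y')) * M := by
          rw [Finset.sum_const, Finset.card_univ, Fintype.card_fin, nsmul_eq_mul]; push_cast; ring
  -- every probe anchored at `y`
  have hpt : ∀ idx : PK (SiteY i) (Fin (d + 1)) κ, blkPK (sIK i bI) idx = y →
      |probeK b g w w₀ (T' A) idx| ≤ ((d + 1 : ℕ) : ℝ) * |γ| * Cb * (geo9K i).len y ^ (1 - βh) * Real.exp (-(δ * (geo9K i).dist y y')) * M := by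
    intro idx hidx
    rcases idx with ⟨⟨x, x'⟩, ν, a, c'⟩ | ⟨⟨x, x'⟩, ν, a, c'⟩ | ⟨x, ν, c, c'⟩
    · rw [probeK_inl_of_dirSum i b g w w₀ hT A x x' ν a c']
      exact fin ν (fun μ => Sum.inl ((x, x'), μ, a, c')) fun μ => hidx
    · rw [probeK_inr_inl_of_dirSum i b g w w₀ hT A x x' ν a c']
      exact fin ν (fun μ => Sum.inr (Sum.inl ((x, x'), μ, a, c'))) fun μ => hidx
    · rw [probeK_inr_inr_of_dirSum i b g w w₀ hT A x ν c c']
      exact fin ν (fun μ => Sum.inr (Sum.inr (x, μ, c, c'))) fun μ => hidx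
  -- assemble the `𝔠_P^{(β−1)}` size at `y`
  have hloc : (BlockNorm.ofBlocks (toB6 (geo9K i) R₀ H₀) (blkPK (sIK i bI))).loc y ((probeK b g w w₀ ∘ₗ T') A) ≤
      ((d + 1 : ℕ) : ℝ) * |γ| * Cb * (geo9K i).len y ^ (1 - βh) * Real.exp (-(δ * (geo9K i).dist y y')) * M :=
    ofBlocks_loc_le_of_forall i (blkPK (sIK i bI)) (by positivity) hpt
  show (cNormR R₀ H₀ (blkPK (sIK i bI)) hG.lenle (βh - 1)).loc y ((probeK b g w w₀ ∘ₗ T') A) ≤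
    ((d + 1 : ℕ) : ℝ) * |γ| * Cb * Real.exp (-(δ * (geo9K i).dist y y')) * M
  rw [cNormR_loc]
  calc (geo9K i).len y ^ (βh - 1) * (BlockNorm.ofBlocks (toB6 (geo9K i) R₀ H₀) (blkPK (sIK i bI))).loc y ((probeK b g w w₀ ∘ₗ T') A)
      ≤ (geo9K i).len y ^ (βh - 1) * (((d + 1 : ℕ) : ℝ) * |γ| * Cb * (geo9K i).len y ^ (1 - βh) * Real.exp (-(δ * (geo9K i).dist y y')) * M) :=
        mul_le_mul_of_nonneg_left hloc (Real.rpow_nonneg hlen0.le _)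
    _ = ((d + 1 : ℕ) : ℝ) * |γ| * Cb * ((geo9K i).len y ^ (βh - 1) * (geo9K i).len y ^ (1 - βh)) * Real.exp (-(δ * (geo9K i).dist y y')) * M := by ring
    _ = ((d + 1 : ℕ) : ℝ) * |γ| * Cb * Real.exp (-(δ * (geo9K i).dist y y')) * M := by
        rw [← Real.rpow_add hlen0, show βh - 1 + (1 - βh) = 0 by ring, Real.rpow_zero, mul_one]

end Transfer

/-! ## §3 ★★★ At the near site probe carrier: `G′ ∘ ∇\*_U` (and `∇\*_U`) on def-Y's bond source from the direction-packed site source -/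

section Instances

variable (i : KIdx d ℓ hd hL b₀ b₁) (b : Module.Basis κ ℝ 𝔸) [FiniteDimensional ℝ 𝔸] [Fintype (geo9K i).Site]
variable {B : B9.Backgrounds} (cfg : B.Cfg → CfgY 𝔸 i) (O : SiteOpY 𝔸 i) (par : SiteParY 𝔸 i) (U₁ : B.Cfg) {bI : FBondY i → IBondY i}
variable {R₀ : ℝ} {H₀ : Prop}

/-- ★★★ **`Φ^X_β ∘ (G′ ∘ ∇\*_U)` ON THE BOND SOURCE.**  Under print's units `|c_f| = N_T` and a direction-blind `bI`: the near site probe member of `GcoS O ∘ DscoS` from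
`𝔠⁽⁰⁾_{blkSK(sIK bI)}` with constant `C_b e^{−δd}` gives the member of `GcoS O ∘ DvscoKH` from `𝔠⁽⁰⁾_{blkBK bI}` with constant `(d+1)·C_b e^{−δd}` — the source side of the
certificate's `h43Gp ∕ hp45W` shapes. [cite: Balaban1985BackgroundPropagators, Thm 3.1 (3.43) p.398 («G′(U)∇*_U») + (3.8) p.392 + (3.40) p.397; Balaban1984PropagatorsII, (2.51)–(2.52) p.232] -/
theorem hasMaj_probesSN_GcoS_DvscoKH_of_DscoS (hG : GeoOK (geo9K i)) (hbI0 : ∀ x : FBondY i, bI x = bI ⟨x.src, 0⟩) (hcf : |i.cf| = (nKT (toKT i) : ℝ))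
    {βh Cb δ : ℝ} (hCb : 0 ≤ Cb)
    (hpr : HasMaj (cNormR R₀ H₀ (blkSK i (sIK i bI)) hG.lenle 0) (cNormR R₀ H₀ (blkPK (sIK i bI)) hG.lenle (βh - 1))
      ((holderProbesSN i b B cfg par bI).ΦX U₁ βh ∘ₗ (GcoS i b B cfg O U₁ ∘ₗ DscoS i b B cfg U₁)) (fun a a' => Cb * Real.exp (-(δ * (geo9K i).dist a a')))) :
    HasMaj (cNormR R₀ H₀ (blkBK i bI) hG.lenle 0) (cNormR R₀ H₀ (blkPK (sIK i bI)) hG.lenle (βh - 1))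
      ((holderProbesSN i b B cfg par bI).ΦX U₁ βh ∘ₗ (GcoS i b B cfg O U₁ ∘ₗ DvscoKH i b B cfg U₁))
      (fun a a' => ((d + 1 : ℕ) : ℝ) * Cb * Real.exp (-(δ * (geo9K i).dist a a'))) := by
  have hγ : |i.cf * etaS i| = 1 := by
    rw [abs_mul, abs_of_pos (etaS_pos i), hcf]
    unfold etaS
    exact mul_inv_cancel₀ (nKT_pos (toKT i)).ne'
  rw [ΦX_SN_eq] at hpr ⊢
  have h := hasMaj_probe_of_dirSum i b hG hbI0 (fun x x' : SiteY i => par (cfg U₁) x x') (wSN i βh) (fun _ => 1)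
    (T' := GcoS i b B cfg O U₁ ∘ₗ DvscoKH i b B cfg U₁) (T := GcoS i b B cfg O U₁ ∘ₗ DscoS i b B cfg U₁) (γ := i.cf * etaS i)
    (GcoS_DvscoKH_apply_eq_sum i b B cfg O U₁) hCb hpr
  refine h.mono fun a a' => le_of_eq ?_
  rw [hγ, mul_one]

omit [FiniteDimensional ℝ 𝔸] in
/-- ★ **`Φ^X_β ∘ ∇\*_U` ON THE BOND SOURCE** — the same for the bare divergence (`T′ = DvscoKH`, `T = DscoS`).
[cite: Balaban1985BackgroundPropagators, (3.8) p.392 + (3.40) p.397; Balaban1984PropagatorsII, (2.51)–(2.52) p.232] -/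
theorem hasMaj_probesSN_DvscoKH_of_DscoS (hG : GeoOK (geo9K i)) (hbI0 : ∀ x : FBondY i, bI x = bI ⟨x.src, 0⟩) (hcf : |i.cf| = (nKT (toKT i) : ℝ))
    {βh Cb δ : ℝ} (hCb : 0 ≤ Cb)
    (hpr : HasMaj (cNormR R₀ H₀ (blkSK i (sIK i bI)) hG.lenle 0) (cNormR R₀ H₀ (blkPK (sIK i bI)) hG.lenle (βh - 1))
      ((holderProbesSN i b B cfg par bI).ΦX U₁ βh ∘ₗ DscoS i b B cfg U₁) (fun a a' => Cb * Real.exp (-(δ * (geo9K i).dist a a')))) :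
    HasMaj (cNormR R₀ H₀ (blkBK i bI) hG.lenle 0) (cNormR R₀ H₀ (blkPK (sIK i bI)) hG.lenle (βh - 1))
      ((holderProbesSN i b B cfg par bI).ΦX U₁ βh ∘ₗ DvscoKH i b B cfg U₁)
      (fun a a' => ((d + 1 : ℕ) : ℝ) * Cb * Real.exp (-(δ * (geo9K i).dist a a'))) := by
  have hγ : |i.cf * etaS i| = 1 := by
    rw [abs_mul, abs_of_pos (etaS_pos i), hcf]
    unfold etaS
    exact mul_inv_cancel₀ (nKT_pos (toKT i)).ne'
  rw [ΦX_SN_eq] at hpr ⊢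
  have h := hasMaj_probe_of_dirSum i b hG hbI0 (fun x x' : SiteY i => par (cfg U₁) x x') (wSN i βh) (fun _ => 1)
    (T' := DvscoKH i b B cfg U₁) (T := DscoS i b B cfg U₁) (γ := i.cf * etaS i)
    (DvscoKH_apply_eq_sum i b B cfg U₁) hCb hpr
  refine h.mono fun a a' => le_of_eq ?_
  rw [hγ, mul_one]

end Instances

end Literature.MathematicalPhysics.QuantumFieldTheory.Balaban1983to89.B9Eq340ProbeBridgeDstarSN

end
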